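import Literature.NumberTheory.Transcendental.CurvePeriodsGmLoopsProofs
import Mathlib.LinearAlgebra.FiniteDimensional.Basic
import Mathlib.LinearAlgebra.Dimension.Constructions
import HarnessLib

/-!
# Crux-triage r1-3 evidence (stmt-KontsevichZagierPeriods-14055), card `kleinian-sigma-presentation`

The typed first lemma `kleinianSigma_genusTwo` (crux dir `SketchIdeator1.lean`) quantifies over
ALL algebraic `lam : Fin 5 → ℂ` subject only to `(curveV lam).IsSmoothAffineCurve`. This file
kernel-checks that the DEGENERATE parameter `lam = 0` (quintic `4x⁵`: the cuspidal RATIONAL curve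
`y² = 4x⁵`) satisfies that hypothesis: the model `{y² = 4x⁵, w·y = 1} ⊂ 𝔸³` removes the cusp
`y = 0`, so it is a smooth affine curve in the sense of `CurveData.IsSmoothAffineCurve`.
On it `du₁ = w dx`, `du₂ = x w dx` pull back along `t ↦ (t², 2t⁵, 1/(2t⁵))` (`t ∈ ℂˣ`) to the
residue-free forms `t⁻⁴ dt`, `t⁻² dt`: every closed period vanishes, and the Abel sums are RATIONAL
functions of the end points, so clause (iii) (Jacobi inversion) of the lemma would make the
`Λ`-periodic meromorphic `℘₂₂ = −∂₂² log σ` a non-constant rational function — impossible for a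
rank-4 lattice. Hence the lemma is false as typed; repair: add `Squarefree (quintic lam)` /
`disc ≠ 0` (genus 2). See TRIAGE-r1-3.md of the crux.
-/

noncomputable section

open scoped BigOperators Topology
open MvPolynomial Set Filter
open Literature.NumberTheory.Transcendental Literature.NumberTheory.Transcendental.CurvePeriods

namespace TriageKleinian

/-- Verbatim from `SketchIdeator1.quintic`: `4x⁵ + λ₄x⁴ + ⋯ + λ₀`. -/
def quintic (lam : Fin 5 → ℂ) : MvPolynomial (Fin 3) ℂ :=
  C 4 * X 0 ^ 5 + ∑ i : Fin 5, C (lam i) * X 0 ^ (i : ℕ)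

/-- Verbatim from `SketchIdeator1.curveV`: `{y² = f(x), w·y = 1} ⊂ 𝔸³`. -/
abbrev curveV (lam : Fin 5 → ℂ) : CurveData := ⟨3, 2, ![X 1 ^ 2 - quintic lam, X 2 * X 1 - 1]⟩

/-- At `λ = 0` the quintic is `4x⁵`. -/
theorem quintic_zero : quintic 0 = C 4 * X 0 ^ 5 := by
  simp [quintic]

/-- Points of `V₀`: `p₁² = 4 p₀⁵` and `p₂ p₁ = 1`. -/
theorem mem_points_iff (p : Fin 3 → ℂ) :
    p ∈ (curveV 0).points ↔ p 1 ^ 2 = 4 * p 0 ^ 5 ∧ p 2 * p 1 = 1 := by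
  rw [CurveData.mem_points,
    show (∀ j : Fin (curveV 0).m, eval p ((curveV 0).F j) = 0) ↔
      eval p ((curveV 0).F 0) = 0 ∧ eval p ((curveV 0).F 1) = 0 from Fin.forall_fin_two]
  simp [quintic_zero, sub_eq_zero]

/-- `∂(y² − 4x⁵)/∂y = 2y` at `p`. -/
theorem grad_zero_apply_one (p : Fin 3 → ℂ) : (curveV 0).gradient 0 p 1 = 2 * p 1 := by
  simp [CurveData.gradient, quintic_zero, Derivation.leibniz_pow]

/-- `∂(y² − 4x⁵)/∂w = 0` at `p`. -/
theorem grad_zero_apply_two (p : Fin 3 → ℂ) : (curveV 0).gradient 0 p 2 = 0 := by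
  simp [CurveData.gradient, quintic_zero, Derivation.leibniz_pow]

/-- `∂(wy − 1)/∂y = w` at `p`. -/
theorem grad_one_apply_one (p : Fin 3 → ℂ) : (curveV 0).gradient 1 p 1 = p 2 := by
  simp [CurveData.gradient]

/-- `∂(wy − 1)/∂w = y` at `p`. -/
theorem grad_one_apply_two (p : Fin 3 → ℂ) : (curveV 0).gradient 1 p 2 = p 1 := by
  simp [CurveData.gradient]

/-- The real curve `s ↦ ((1+s)² p₀, (1+s)⁵ p₁, (1+s)⁻⁵ p₂)` through `p` inside `V₀`. -/
def defo (p : Fin 3 → ℂ) (s : ℝ) : Fin 3 → ℂ :=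
  ![(1 + (s : ℂ)) ^ 2 * p 0, (1 + (s : ℂ)) ^ 5 * p 1, ((1 + (s : ℂ)) ^ 5)⁻¹ * p 2]

theorem defo_zero (p : Fin 3 → ℂ) : defo p 0 = p := by
  funext k
  fin_cases k <;> simp [defo]

theorem defo_mem_points {p : Fin 3 → ℂ} (hp : p ∈ (curveV 0).points) {s : ℝ}
    (hs : (1 + (s : ℂ)) ≠ 0) : defo p s ∈ (curveV 0).points := by
  rw [mem_points_iff] at hp ⊢
  obtain ⟨h1, h2⟩ := hp
  refine ⟨?_, ?_⟩
  · simp only [defo, Matrix.cons_val_one, Matrix.cons_val_zero]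
    calc ((1 + (s : ℂ)) ^ 5 * p 1) ^ 2 = (1 + (s : ℂ)) ^ 10 * p 1 ^ 2 := by ring
      _ = (1 + (s : ℂ)) ^ 10 * (4 * p 0 ^ 5) := by rw [h1]
      _ = 4 * ((1 + (s : ℂ)) ^ 2 * p 0) ^ 5 := by ring
  · simp only [defo, Matrix.cons_val_two, Matrix.tail_cons, Matrix.head_cons, Matrix.cons_val_one]
    have h5 : (1 + (s : ℂ)) ^ 5 ≠ 0 := pow_ne_zero 5 hs
    calc ((1 + (s : ℂ)) ^ 5)⁻¹ * p 2 * ((1 + (s : ℂ)) ^ 5 * p 1)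
        = (((1 + (s : ℂ)) ^ 5)⁻¹ * (1 + (s : ℂ)) ^ 5) * (p 2 * p 1) := by ring
      _ = 1 := by rw [inv_mul_cancel₀ h5, h2, one_mul]

theorem continuous_defo (p : Fin 3 → ℂ) : ContinuousAt (defo p) 0 := by
  apply continuousAt_pi.2
  intro k
  have hc : Continuous fun s : ℝ => (1 + (s : ℂ)) := by fun_prop
  fin_cases k
  · simp only [defo]
    exact ((hc.pow 2).mul continuous_const).continuousAt
  · simp only [defo]
    exact ((hc.pow 5).mul continuous_const).continuousAt
  · simp only [defo]
    refine ContinuousAt.mul ?_ continuousAt_const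
    refine ContinuousAt.inv₀ ((hc.pow 5).continuousAt) ?_
    simp

/-- **`V₀ = {y² = 4x⁵, w·y = 1}` IS a smooth affine curve over `ℚ̄`** in the sense of the
rendering, although `y² = 4x⁵` is a cuspidal rational curve: the hypothesis `hV` of
`kleinianSigma_genusTwo` does not exclude the degenerate parameter `lam = 0`. [folklore] -/
theorem isSmoothAffineCurve_curveV_zero : (curveV 0).IsSmoothAffineCurve where
  algebraic j := by
    fin_cases j
    · simpa [quintic_zero] using ((hasAlgCoeffs_X (n := 3) 1).pow 2).sub
        ((hasAlgCoeffs_C (isAlgebraic_nat 4)).mul ((hasAlgCoeffs_X (n := 3) 0).pow 5))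
    · simpa using ((hasAlgCoeffs_X (n := 3) 2).mul (hasAlgCoeffs_X 1)).sub hasAlgCoeffs_one
  rank_eq p hp := by
    have hp1 : p 1 ≠ 0 := fun h => by
      rw [mem_points_iff] at hp
      simp [h] at hp
    have hfun : (fun j => (curveV 0).gradient j p) =
        ![(curveV 0).gradient 0 p, (curveV 0).gradient 1 p] := by
      funext j
      fin_cases j <;> simp
    have hli : LinearIndependent ℂ ![(curveV 0).gradient 0 p, (curveV 0).gradient 1 p] := by
      rw [LinearIndependent.pair_iff]
      intro s t hst
      have h2 := congrFun hst 2
      have h1 := congrFun hst 1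
      simp only [Pi.add_apply, Pi.smul_apply, smul_eq_mul, Pi.zero_apply,
        grad_zero_apply_one, grad_zero_apply_two, grad_one_apply_one, grad_one_apply_two,
        mul_zero, zero_add] at h1 h2
      have ht : t = 0 := (mul_eq_zero.mp h2).resolve_right hp1
      rw [ht, zero_mul, add_zero] at h1
      have hs : s = 0 := by
        rcases mul_eq_zero.mp h1 with h | h
        · exact h
        · exact absurd ((mul_eq_zero.mp h).resolve_left two_ne_zero) hp1
      exact ⟨hs, ht⟩
    rw [hfun, finrank_span_eq_card hli]
    rfl
  not_isolated p hp := by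
    have hp' := hp
    rw [mem_points_iff] at hp'
    obtain ⟨h1, h2⟩ := hp'
    have hp1 : p 1 ≠ 0 := fun h => by simp [h] at h2
    have hp0 : p 0 ≠ 0 := fun h => by
      apply hp1
      have : p 1 ^ 2 = 0 := by rw [h1, h]; ring
      exact pow_eq_zero_iff (n := 2) (by norm_num) |>.mp this
    -- points of the deformation, for real `s` with `|s| < 1`, `s ≠ 0`
    have hev : ∀ᶠ s : ℝ in 𝓝[≠] 0, defo p s ∈ (curveV 0).points \ {p} := by
      have hsmall : ∀ᶠ s : ℝ in 𝓝[≠] (0 : ℝ), |s| < 1 ∧ s ≠ 0 := by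
        have h1' : ∀ᶠ s : ℝ in 𝓝 (0 : ℝ), |s| < 1 := by
          have : Iio (1 : ℝ) ∈ 𝓝 (|(0 : ℝ)|) := by simpa using Iio_mem_nhds (zero_lt_one' ℝ)
          exact (continuous_abs.tendsto 0).eventually_mem this
        exact (h1'.filter_mono nhdsWithin_le_nhds).and eventually_mem_nhdsWithin
      filter_upwards [hsmall] with s hs
      obtain ⟨hs1, hs0⟩ := hs
      have hne : (1 + (s : ℂ)) ≠ 0 := by
        intro h
        have hre := congrArg Complex.re h
        simp at hre
        have : (-1 : ℝ) < s := by
          have := abs_lt.mp hs1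
          linarith [this.1]
        linarith
      refine ⟨defo_mem_points hp hne, ?_⟩
      -- `defo p s ≠ p`: compare the `x`-coordinates
      intro heq
      have h0 := congrFun (mem_singleton_iff.mp heq) 0
      simp only [defo, Matrix.cons_val_zero] at h0
      have hsq : (1 + (s : ℂ)) ^ 2 = 1 := by
        have := mul_right_cancel₀ hp0 (h0.trans (one_mul (p 0)).symm)
        exact this
      have hre := congrArg Complex.re hsq
      have hexp : ((1 + (s : ℂ)) ^ 2).re = (1 + s) ^ 2 := by
        have : (1 + (s : ℂ)) = ((1 + s : ℝ) : ℂ) := by push_cast; ring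
        rw [this, ← Complex.ofReal_pow, Complex.ofReal_re]
      have hre' : (1 + s) ^ 2 = 1 := by
        rw [hexp] at hre
        simpa only [Complex.one_re] using hre
      -- `(1+s)² = 1` with `|s| < 1`, `s ≠ 0`: impossible
      have hs' : s * (s + 2) = 0 := by linear_combination hre'
      rcases mul_eq_zero.mp hs' with h | h
      · exact hs0 h
      · have := abs_lt.mp hs1
        linarith [this.1]
    have htend : Tendsto (defo p) (𝓝[≠] (0 : ℝ)) (𝓝 p) := by
      have h := (continuous_defo p).tendsto
      rw [defo_zero] at h
      exact h.mono_left nhdsWithin_le_nhds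
    exact mem_closure_of_tendsto htend hev

end TriageKleinian

end
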